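import Literature.Probability.RandomPlanarGeometry.CardyFunctionIncBeta
import Literature.Probability.RandomPlanarGeometry.ConformalRectangle
import Mathlib.Analysis.SpecialFunctions.Log.Basic
import Mathlib.Analysis.SpecialFunctions.Pow.Real
import HarnessLib

/-!
# Line `Sketch` — crux 5 ⟹ crux 6, analysis stubs: Cardy's function near `0` and the log-slopes
# `-1/3` along the two integer mark chains (crux stmt-CriticalPhenomena-5661, lead c10-0)

Pure real analysis about Cardy's function `F(η) = cardyConst · η^{1/3} · ₂F₁(1/3, 2/3; 4/3; η)`:

* `stub_cardySmall`: `c₁ η^{1/3} ≤ F(η) ≤ c₂ η^{1/3}` on `(0, 1/2]`, with `c₁ = cardyConst` and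
  `c₂ = cardyConst · ∑ αₙ` (`1 = α₀ ≤ ₂F₁(η) = ∑ αₙ ηⁿ ≤ ∑ αₙ < ∞`, `αₙ ≥ 0`).
* `stub_upperSlope`: `log (C F(η(2,4,K,2K))) / log (4K) → -1/3`, `η(2,4,K,2K) = K/(K-2)² ≍ 1/K`.
* `stub_lowerSlope`: `log (C F(η(0,1,16K+1,32K))) / log (4K) → -1/3`,
  `η(0,1,16K+1,32K) = (16K-1)/((16K+1)(32K-1)) ≍ 1/K`.

Both slopes follow from the squeeze `stub_slope_aux`: if `a/K ≤ η_K ≤ b/K` and `η_K ≤ 1/2`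
eventually, then `log (C F(η_K)) = -(1/3) log K + O(1)` while `log (4K) = log K + log 4`.
-/

noncomputable section

namespace Summit.CriticalPhenomena.CardyFormulaZ2.Cruxes.HalfPlaneMarkDensityLaw.SketchLine

open Literature.Probability.RandomPlanarGeometry Filter Set
open scoped Topology

namespace OneArm

/-! ## Cardy's function near `0` -/

/-- The constant coefficient of the Gauss series of `₂F₁(1/3, 2/3; 4/3; ·)` is `α₀ = 1`. [folklore] -/
private theorem stub_cardySmall_aux_coeff_zero : cardyCoeff 0 = 1 := by
  simp [cardyCoeff]

/-- For `0 ≤ η ≤ 1/2`: `1 ≤ ₂F₁(1/3, 2/3; 4/3; η) ≤ ∑ αₙ` (nonnegative Gauss series inside the unit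
disc, compared termwise with its values at `0` and at `1`). [folklore] -/
private theorem stub_cardySmall_aux_hyp {η : ℝ} (h0 : 0 ≤ η) (h1 : η ≤ 1 / 2) :
    1 ≤ ₂F₁ (1 / 3 : ℝ) (2 / 3 : ℝ) (4 / 3 : ℝ) η ∧
      ₂F₁ (1 / 3 : ℝ) (2 / 3 : ℝ) (4 / 3 : ℝ) η ≤ ∑' n, cardyCoeff n := by
  have hx : |η| < 1 := abs_lt.2 ⟨by linarith, by linarith⟩
  have hS := hasSum_cardyCoeff hx
  constructor
  · have h := le_hasSum hS 0 (fun n _ ↦ mul_nonneg (cardyCoeff_nonneg n) (pow_nonneg h0 n))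
    simpa [stub_cardySmall_aux_coeff_zero] using h
  · refine hasSum_le (fun n ↦ ?_) hS summable_cardyCoeff.hasSum
    exact mul_le_of_le_one_right (cardyCoeff_nonneg n) (pow_le_one₀ h0 (by linarith))

/-- STUB (analysis) `stub_cardySmall`: two-sided `η^{1/3}` bounds for Cardy's function near `0`:
there are `c₁, c₂ > 0` with `c₁ η^{1/3} ≤ F(η) ≤ c₂ η^{1/3}` for `0 < η ≤ 1/2`
(`F(η) = cardyConst · η^{1/3} · ₂F₁(1/3,2/3;4/3;η)` with `1 ≤ ₂F₁ ≤ Σ αₙ < ∞` on `[0, 1/2]`). [folklore] -/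
theorem stub_cardySmall : ∃ c₁ c₂ : ℝ, 0 < c₁ ∧ 0 < c₂ ∧ ∀ η : ℝ, 0 < η → η ≤ 1 / 2 →
    c₁ * η ^ (1 / 3 : ℝ) ≤ Literature.Probability.RandomPlanarGeometry.cardyFunction η ∧
      Literature.Probability.RandomPlanarGeometry.cardyFunction η ≤ c₂ * η ^ (1 / 3 : ℝ) := by
  have hS1 : 1 ≤ ∑' n, cardyCoeff n := by
    have h := summable_cardyCoeff.le_tsum 0 (fun n _ ↦ cardyCoeff_nonneg n)
    rwa [stub_cardySmall_aux_coeff_zero] at h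
  refine ⟨cardyConst, cardyConst * ∑' n, cardyCoeff n, cardyConst_pos,
    mul_pos cardyConst_pos (by linarith), fun η h0 h1 ↦ ?_⟩
  obtain ⟨hlo, hhi⟩ := stub_cardySmall_aux_hyp h0.le h1
  have hc : 0 < cardyConst * η ^ (1 / 3 : ℝ) := mul_pos cardyConst_pos (Real.rpow_pos_of_pos h0 _)
  rw [cardyFunction_eq_cardyConst_mul]
  constructor
  · calc cardyConst * η ^ (1 / 3 : ℝ) = cardyConst * η ^ (1 / 3 : ℝ) * 1 := (mul_one _).symm
      _ ≤ _ := mul_le_mul_of_nonneg_left hlo hc.le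
  · calc _ ≤ cardyConst * η ^ (1 / 3 : ℝ) * ∑' n, cardyCoeff n := mul_le_mul_of_nonneg_left hhi hc.le
      _ = _ := by ring

/-! ## The squeeze behind both slopes -/

/-- The common squeeze: if eventually `a/K ≤ η_K ≤ b/K` and `η_K ≤ 1/2` (`a, b > 0`), then for every
`C > 0`, `log (C F(η_K)) / log (4K) → -1/3` (`c₁ (a/K)^{1/3} ≤ F(η_K) ≤ c₂ (b/K)^{1/3}` by
`stub_cardySmall`, so `log (C F(η_K)) = -(1/3) log (4K) + O(1)`). [folklore] -/
private theorem stub_slope_aux {η : ℕ → ℝ} {a b : ℝ} (ha : 0 < a) (hb : 0 < b)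
    (hη : ∀ᶠ K : ℕ in atTop, a / K ≤ η K ∧ η K ≤ b / K ∧ η K ≤ 1 / 2) {C : ℝ} (hC : 0 < C) :
    Tendsto (fun K : ℕ ↦ Real.log (C * cardyFunction (η K)) / Real.log ((4 * K : ℕ) : ℝ)) atTop
      (𝓝 (-(1 / 3 : ℝ))) := by
  obtain ⟨c₁, c₂, hc₁, hc₂, hF⟩ := stub_cardySmall
  -- `log (4K) → ∞`
  have hu : Tendsto (fun K : ℕ ↦ Real.log ((4 * K : ℕ) : ℝ)) atTop atTop :=
    Real.tendsto_log_atTop.comp (tendsto_natCast_atTop_atTop.comp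
      (Tendsto.const_mul_atTop' (by norm_num : (0 : ℕ) < 4) tendsto_id))
  -- the two squeezing sequences `(A - (1/3) log (4K)) / log (4K) → -1/3`
  have hlim : ∀ A : ℝ, Tendsto (fun K : ℕ ↦ (A - 1 / 3 * Real.log ((4 * K : ℕ) : ℝ)) /
      Real.log ((4 * K : ℕ) : ℝ)) atTop (𝓝 (-(1 / 3 : ℝ))) := fun A ↦ by
    have h1 : Tendsto (fun K : ℕ ↦ A / Real.log ((4 * K : ℕ) : ℝ) - 1 / 3) atTop
        (𝓝 (0 - 1 / 3 : ℝ)) := (tendsto_const_nhds.div_atTop hu).sub_const _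
    rw [zero_sub] at h1
    refine h1.congr' ?_
    filter_upwards [hu.eventually_gt_atTop 0] with K hK
    rw [sub_div, mul_div_assoc, div_self hK.ne', mul_one]
  refine tendsto_of_tendsto_of_tendsto_of_le_of_le'
    (hlim (Real.log C + Real.log c₁ + 1 / 3 * (Real.log a + Real.log 4)))
    (hlim (Real.log C + Real.log c₂ + 1 / 3 * (Real.log b + Real.log 4))) ?_ ?_
  all_goals filter_upwards [hη, eventually_gt_atTop 0] with K hK hK0
  all_goals
    have hKpos : (0 : ℝ) < K := Nat.cast_pos.2 hK0
    have hu_eq : Real.log ((4 * K : ℕ) : ℝ) = Real.log 4 + Real.log K := by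
      push_cast; exact Real.log_mul (by norm_num) hKpos.ne'
    have hupos : 0 < Real.log ((4 * K : ℕ) : ℝ) := by
      rw [hu_eq]; linarith [Real.log_pos (by norm_num : (1 : ℝ) < 4), Real.log_natCast_nonneg K]
    have haK : 0 < a / K := div_pos ha hKpos
    have hη0 : 0 < η K := haK.trans_le hK.1
    obtain ⟨hF1, hF2⟩ := hF (η K) hη0 hK.2.2
    have hlow : C * (c₁ * (a / K) ^ (1 / 3 : ℝ)) ≤ C * cardyFunction (η K) :=
      mul_le_mul_of_nonneg_left ((mul_le_mul_of_nonneg_left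
        (Real.rpow_le_rpow haK.le hK.1 (by norm_num)) hc₁.le).trans hF1) hC.le
    have hpos : 0 < C * (c₁ * (a / K) ^ (1 / 3 : ℝ)) := by positivity
    refine div_le_div_of_nonneg_right ?_ hupos.le
  · -- lower bound
    have hlog : Real.log (C * (c₁ * (a / K) ^ (1 / 3 : ℝ))) =
        Real.log C + Real.log c₁ + 1 / 3 * (Real.log a - Real.log K) := by
      rw [Real.log_mul hC.ne' (by positivity), Real.log_mul hc₁.ne' (by positivity),
        Real.log_rpow haK, Real.log_div ha.ne' hKpos.ne']
      ring
    linarith [Real.log_le_log hpos hlow]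
  · -- upper bound
    have hbK : 0 < b / K := div_pos hb hKpos
    have hupp : C * cardyFunction (η K) ≤ C * (c₂ * (b / K) ^ (1 / 3 : ℝ)) :=
      mul_le_mul_of_nonneg_left (hF2.trans (mul_le_mul_of_nonneg_left
        (Real.rpow_le_rpow hη0.le hK.2.1 (by norm_num)) hc₂.le)) hC.le
    have hlog : Real.log (C * (c₂ * (b / K) ^ (1 / 3 : ℝ))) =
        Real.log C + Real.log c₂ + 1 / 3 * (Real.log b - Real.log K) := by
      rw [Real.log_mul hC.ne' (by positivity), Real.log_mul hc₂.ne' (by positivity),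
        Real.log_rpow hbK, Real.log_div hb.ne' hKpos.ne']
      ring
    linarith [Real.log_le_log (hpos.trans_le hlow) hupp]

/-! ## The two integer mark chains -/

/-- The upper chain: `η(2,4,K,2K) = K/(K-2)²`, hence `1/K ≤ η ≤ 4/K` and `η ≤ 1/2` for `K ≥ 8`. [folklore] -/
private theorem stub_upperSlope_aux_eta :
    ∀ᶠ K : ℕ in atTop, 1 / (K : ℝ) ≤ crossRatio ![(2 : ℝ), 4, K, 2 * K] ∧
      crossRatio ![(2 : ℝ), 4, K, 2 * K] ≤ 4 / (K : ℝ) ∧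
      crossRatio ![(2 : ℝ), 4, K, 2 * K] ≤ 1 / 2 := by
  filter_upwards [eventually_ge_atTop 8] with K hK
  have hK' : (8 : ℝ) ≤ K := by exact_mod_cast hK
  have hKpos : (0 : ℝ) < K := by linarith
  have hd : (0 : ℝ) < ((K : ℝ) - 2) ^ 2 := pow_pos (by linarith) 2
  have h : crossRatio ![(2 : ℝ), 4, K, 2 * K] = K / ((K : ℝ) - 2) ^ 2 := by
    simp only [crossRatio, Matrix.cons_val_zero, Matrix.cons_val_one, Matrix.cons_val]
    rw [div_eq_div_iff (by nlinarith) hd.ne']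
    ring
  rw [h]
  refine ⟨?_, ?_, ?_⟩
  · rw [div_le_div_iff₀ hKpos hd]; nlinarith
  · rw [div_le_div_iff₀ hd hKpos]; nlinarith
  · rw [div_le_div_iff₀ hd (by norm_num : (0 : ℝ) < 2)]; nlinarith

/-- The lower chain: `η(0,1,16K+1,32K) = (16K-1)/((16K+1)(32K-1))`, hence
`(1/70)/K ≤ η ≤ 1/K` and `η ≤ 1/2` for `K ≥ 2`. [folklore] -/
private theorem stub_lowerSlope_aux_eta :
    ∀ᶠ K : ℕ in atTop, 1 / 70 / (K : ℝ) ≤ crossRatio ![(0 : ℝ), 1, 16 * K + 1, 32 * K] ∧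
      crossRatio ![(0 : ℝ), 1, 16 * K + 1, 32 * K] ≤ 1 / (K : ℝ) ∧
      crossRatio ![(0 : ℝ), 1, 16 * K + 1, 32 * K] ≤ 1 / 2 := by
  filter_upwards [eventually_ge_atTop 2] with K hK
  have hK' : (2 : ℝ) ≤ K := by exact_mod_cast hK
  have hKpos : (0 : ℝ) < K := by linarith
  have hd : (0 : ℝ) < (16 * (K : ℝ) + 1) * (32 * K - 1) := by nlinarith
  have h : crossRatio ![(0 : ℝ), 1, 16 * K + 1, 32 * K] =
      (16 * (K : ℝ) - 1) / ((16 * (K : ℝ) + 1) * (32 * K - 1)) := by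
    simp only [crossRatio, Matrix.cons_val_zero, Matrix.cons_val_one, Matrix.cons_val]
    rw [div_eq_div_iff (by nlinarith) hd.ne']
    ring
  rw [h]
  refine ⟨?_, ?_, ?_⟩
  · rw [div_le_div_iff₀ hKpos hd]; nlinarith
  · rw [div_le_div_iff₀ hd hKpos]; nlinarith
  · rw [div_le_div_iff₀ hd (by norm_num : (0 : ℝ) < 2)]; nlinarith

/-- STUB (analysis) `stub_upperSlope`: for every constant `C > 0`,
`log (C · F(η(2,4,K,2K))) / log (4K) → -1/3` as `K → ∞` (`η(2,4,K,2K) = K/(K-2)² ≍ 1/K`). [folklore] -/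
theorem stub_upperSlope : ∀ C : ℝ, 0 < C →
    Tendsto (fun K : ℕ ↦ Real.log (C * Literature.Probability.RandomPlanarGeometry.cardyFunction
      (Literature.Probability.RandomPlanarGeometry.crossRatio ![(2 : ℝ), 4, K, 2 * K])) /
        Real.log ((4 * K : ℕ) : ℝ)) atTop (𝓝 (-(1 / 3 : ℝ))) :=
  fun _ hC ↦ stub_slope_aux (η := fun K : ℕ ↦ crossRatio ![(2 : ℝ), 4, K, 2 * K]) one_pos
    (by norm_num) stub_upperSlope_aux_eta hC

/-- STUB (analysis) `stub_lowerSlope`: for every constant `C > 0`,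
`log (C · F(η(0,1,16K+1,32K))) / log (4K) → -1/3` as `K → ∞`
(`η(0,1,16K+1,32K) = (16K-1)/((16K+1)(32K-1)) ≍ 1/K`). [folklore] -/
theorem stub_lowerSlope : ∀ C : ℝ, 0 < C →
    Tendsto (fun K : ℕ ↦ Real.log (C * Literature.Probability.RandomPlanarGeometry.cardyFunction
      (Literature.Probability.RandomPlanarGeometry.crossRatio ![(0 : ℝ), 1, 16 * K + 1, 32 * K])) /
        Real.log ((4 * K : ℕ) : ℝ)) atTop (𝓝 (-(1 / 3 : ℝ))) :=
  fun _ hC ↦ stub_slope_aux (η := fun K : ℕ ↦ crossRatio ![(0 : ℝ), 1, 16 * K + 1, 32 * K])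
    (by norm_num) one_pos stub_lowerSlope_aux_eta hC

end OneArm

end Summit.CriticalPhenomena.CardyFormulaZ2.Cruxes.HalfPlaneMarkDensityLaw.SketchLine

end
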